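import Summits.BirchSwinnertonDyer.BirchSwinnertonDyer.Theorems.KimAtThreeDeepUpperKolyvaginPair
import Summits.BirchSwinnertonDyer.Rank1Residual.GaloisImage.KatoKuriharaWitnessPairOfZetaBody
import Summits.BirchSwinnertonDyer.BirchSwinnertonDyer.Theorems.KimAtThreeShallowEqDeepAnomalousRiderGeneralLevel
import HarnessLib

/-!
# Route `KimAtThreeKolyvagin` (W2): the two-depth Kato–Kurihara witness package WITHOUT `hbad`, with the TWISTED
# riders and value rows — THEOREM D-u version (the Kato–Kurihara port on the good ANOMALOUS rows at `3`, rider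
# side, file 3u)

Cell `bsd-addord`, seat `bsd-addord-w2-c4` (gen 9; owner of crux 19599 `ShallowEqDeepOffKatoStratum`, item
19077 `ShallowEqDeepAtTorsionFree`).  `--supports` 19599.  HONEST FRAMING: ONE TOOL THEOREM (no definition, no
named fact, no instance, no `sorry`); `ZetaBody` (`hbody`), the riders' (Λ)-clauses and TWISTED scalar clauses,
THEOREM D-u's row binders and the TWISTED value rows are DISPLAYED HYPOTHESES; nothing is booked; 19599 / 19077 /
19560 stay OPEN; BSD is not proved by any of this.  Credit: seat w2-c3's (gen 5)
`KimAtThreeDeepUpperWitnessPair.exists_katoKuriharaWitnessAt_pair_of_zetaBody_of_unramified` (THEOREM D-u: the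
`hbad`-free pair, Kato's classes unramified away from `3` by (C2) of `ZetaBody`) — this file is that theorem
VERBATIM with the rider `KatoExpStarFiniteLevelAt` replaced by its (Λ)-clauses + the TWISTED clause (ii_τ)
(`KimAtThreeShallowEqDeepAnomalousRider`), the value rows by the TWISTED ones (`t = 0`), and GeneralLevel ★ by the
seat's `…AnomalousRiderGeneralLevel.exists_unit_apply_localization_eq_of_derivativeFamily_twist`.
HONEST LIMITS as there (`t = 0` rows via `htopk`/`htopm`); nothing booked.

References: [Kato2004Asterisque] (8.1.3) p. 180, §9.4, Thm. 9.7; [Kim2022StructureSelmer] Thm. 3.13, §2.2.2,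
§3.3–§3.4.1; [MazurRubin2004] Def. 3.1.3, Thm. 3.2.4, App. A (Remark A.5); [Rubin2000] Def. 4.4.4, Thm. 4.5.1;
[Sakamoto2024] Def. 4.1.
-/

set_option autoImplicit false
-- the Theorems namespace of a single-conjunct summit repeats the summit name by design (D-0017)
set_option linter.dupNamespace false

noncomputable section

open scoped NumberField TensorProduct ContRepresentation Classical
open CategoryTheory Field Function Finset IsDedekindDomain NumberField WeierstrassCurve
open Rat.HeightOneSpectrum
open Literature.NumberTheory.GaloisRepresentations Literature.NumberTheory.GaloisCohomology
open Literature.NumberTheory.GaloisRepresentations.DiscreteGaloisModule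
open Literature.NumberTheory.EllipticCurves Literature.NumberTheory.EllipticCurves.ModularForms
open Literature.NumberTheory.EllipticCurves.Kato2004
open Literature.NumberTheory.EllipticCurves.Kato2004.EulerSystemValues
open Summit.BirchSwinnertonDyer.Rank1Residual.GaloisImage
open Summit.BirchSwinnertonDyer.Rank1Residual.GaloisImage.TorsionCoeff
open Summit.BirchSwinnertonDyer.Rank1Residual.GaloisImage.KatoValue
open Summit.BirchSwinnertonDyer.BirchSwinnertonDyer.Theorems

namespace Summit.BirchSwinnertonDyer.BirchSwinnertonDyer.Theorems.KimAtThreeShallowEqDeepAnomalousWitnessPairUnramified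

variable (W : WeierstrassCurve ℚ) [W.IsElliptic] [W.IsGloballyMinimal]
  [ContinuousSMul ℤ_[3] (W.tateModule 3)] [Module.Free ℤ_[3] (W.tateModule 3)]
  [Module.Finite ℤ_[3] (W.tateModule 3)]

/-- Local notation: `𝐃F⟦r, τ⟧ ℓ = Σ_{j<ℓ−1} j·σ_{χ_{m(0,r)}(τ_ℓ)}^j` on the level field `ℚ(ζ_{m(0,r)})`
(PK-1 ★2's field-side spelling, `p = 3`). -/
local notation3 (prettyPrint := false) "𝐃F⟦" r ", " τ "⟧" =>
  fun ℓ : HeightOneSpectrum (𝓞 ℚ) =>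
  ∑ j ∈ Finset.range (((primesEquiv ℓ : Nat.Primes) : ℕ) - 1),
    (j : Module.End ℚ (CyclotomicField (cycLevel 3 0 r) ℚ)) *
      (sigma (cycLevel 3 0 r) (modNCyclotomicCharacter ℚ (cycLevel 3 0 r)
          ((τ : HeightOneSpectrum (𝓞 ℚ) → absoluteGaloisGroup ℚ) ℓ)) :
        CyclotomicField (cycLevel 3 0 r) ℚ →ₐ[ℚ] CyclotomicField (cycLevel 3 0 r) ℚ).toLinearMap ^ j

set_option backward.isDefEq.respectTransparency false in
/-- **★★ The two-depth Kato–Kurihara witness package from `ZetaBody`, THEOREM D-u, the TWISTED riders and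
TWISTED value rows, WITHOUT `hbad`** (module docstring): `KatoKuriharaWitnessAt W k 0 D v₃ P κ Λk κ`,
`KatoKuriharaWitnessAt W m 0 D″ v₃ P κu Λm κu` for THE Kolyvagin systems of THEOREM D-u, and (COMP).
[cite: Kato2004Asterisque, (8.1.3) (p. 180), §9.4 (p. 188) and Thm. 9.7 (p. 189)]
[cite: Kim2022StructureSelmer, Thm. 3.13 and §2.2.2, §3.3–§3.4.1 (arXiv v3 pp. 12, 17–18, 26–27)]
[cite: MazurRubin2004, Def. 3.1.3, Thm. 3.2.4 and App. A Remark A.5] [cite: Rubin2000, Def. 4.4.4 and Thm. 4.5.1] -/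
theorem exists_katoKuriharaWitnessAt_pair_of_zetaBody_of_unramified_twist
    {N : ℕ} [NeZero N] (P : ModularParametrizationData W N)
    {ι : (n : ℕ) → (CyclotomicField n ℚ →+* ℂ)} {κK : ℝ}
    {Λ : ∀ (k' : ℕ) (r : Finset (HeightOneSpectrum (𝓞 ℚ))),
      H1 (tateRep W 3) (cycSubgroup 3 k' r) →ₗ[ℤ_[3]] ℚ_[3] ⊗[ℚ] CyclotomicField (cycLevel 3 k' r) ℚ}
    {c d a : ℤ} {A : ℕ}
    {z : ∀ (k' : ℕ) (r : (cyclotomicLevelsRat 3 (badPlaces c d A N)).Ideals),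
      H1 (tateRep W 3) ((cyclotomicLevelsRat 3 (badPlaces c d A N)).level k' r.1)}
    {x : ∀ (k' : ℕ) (r : (cyclotomicLevelsRat 3 (badPlaces c d A N)).Ideals),
      CyclotomicField (cycLevel 3 k' r.1) ℚ}
    (hbody : ZetaBody W 3 P.f ι κK Λ c d a A z x)
    (hirr : W.HasIrreducibleModPGaloisRep 3)
    -- the two depths and THE reduction
    {k m : ℕ} (hkm : k ≤ m)
    (π : (W.torsionGaloisModule (((3 : ℕ) : ℤ) ^ m * ((3 : ℕ) : ℤ))).toContRepresentation →ⁱL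
      (W.torsionGaloisModule (((3 : ℕ) : ℤ) ^ k * ((3 : ℕ) : ℤ))).toContRepresentation)
    (hπ : ∀ y : geomTorsion W (((3 : ℕ) : ℤ) ^ m * ((3 : ℕ) : ℤ)),
      ((π y : geomTorsion W (((3 : ℕ) : ℤ) ^ k * ((3 : ℕ) : ℤ))) : geomPoints W) =
        (((3 : ℕ) : ℤ) ^ (m - k)) • (y : geomPoints W))
    -- the riders at `v₃ ∣ 3`, depths `k` and `m`, same `Λ`
    {v₃ : HeightOneSpectrum (𝓞 ℚ)} (hv₃ : ((3 : ℕ) : 𝓞 ℚ) ∈ v₃.asIdeal)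
    {Λk : galoisCohomology ((W.torsionGaloisModule (((3 : ℕ) : ℤ) ^ k * ((3 : ℕ) : ℤ))).toLocal
      (Sum.inr v₃)) 1 →+ ZMod (3 ^ (k + 1))}
    {Λm : galoisCohomology ((W.torsionGaloisModule (((3 : ℕ) : ℤ) ^ m * ((3 : ℕ) : ℤ))).toLocal
      (Sum.inr v₃)) 1 →+ ZMod (3 ^ (m + 1))} (ap : ℤ)
    -- the riders' (Λ)-clauses (i) at both depths (DICT3's, verbatim)
    (hΛk : (∀ c : ZMod (3 ^ (k + 1)), ∃ x ∈ propagatedSelmerStructure W 3 k (Sum.inr v₃), Λk x = c) ∧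
      (∀ x ∈ propagatedSelmerStructure W 3 k (Sum.inr v₃),
        Λk x = 0 ↔ x ∈ W.kummerSelmerStructure (((3 : ℕ) : ℤ) ^ k * ((3 : ℕ) : ℤ)) (Sum.inr v₃)))
    (hΛm : (∀ c : ZMod (3 ^ (m + 1)), ∃ x ∈ propagatedSelmerStructure W 3 m (Sum.inr v₃), Λm x = c) ∧
      (∀ x ∈ propagatedSelmerStructure W 3 m (Sum.inr v₃),
        Λm x = 0 ↔ x ∈ W.kummerSelmerStructure (((3 : ℕ) : ℤ) ^ m * ((3 : ℕ) : ℤ)) (Sum.inr v₃)))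
    -- the riders' TWISTED scalar clauses (ii_τ) at both depths
    -- the ANOMALOUS rider's scalar clause (ii_τ): the premise is stated on the TWISTED lattice `(1 ⊗ P_w)·L_int`,
    -- `P_w = p − a_pδ_w + δ_{w²}`, `w·[p] = 1`, with the scalar `s·(p − a_p + 1) = s·#Ẽ(𝔽_p)`
    (hfinτk : ∀ (r : Finset (HeightOneSpectrum (𝓞 ℚ))) (w : (ZMod (cycLevel 3 0 r))ˣ),
      (w : ZMod (cycLevel 3 0 r)) * ((3 : ℕ) : ZMod (cycLevel 3 0 r)) = 1 →
      ∀ (Ψ : H1 (tateRep W 3) (cycSubgroup 3 0 r) →+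
          continuousCohomology 1
            (subgroupRep (W.torsionGaloisModule (((3 : ℕ) : ℤ) ^ k * ((3 : ℕ) : ℤ))).toTopRep (cycSubgroup 3 0 r))),
        (∀ (φ : contOneCocycles (subgroupRep (tateRep W 3).toTopRep (cycSubgroup 3 0 r)))
            (ψ : contOneCocycles
              (subgroupRep (W.torsionGaloisModule (((3 : ℕ) : ℤ) ^ k * ((3 : ℕ) : ℤ))).toTopRep (cycSubgroup 3 0 r))),
            (∀ g, ((ψ.1 g : geomTorsion W (((3 : ℕ) : ℤ) ^ k * ((3 : ℕ) : ℤ))) : geomPoints W) =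
              TateModule.proj 3 (k + 1) (φ.1 g)) →
            Ψ (oneCocycleClass _ φ) = oneCocycleClass _ ψ) →
        ∀ (y : H1 (tateRep W 3) (cycSubgroup 3 0 r))
          (κ₀ : galoisCohomology (W.torsionGaloisModule (((3 : ℕ) : ℤ) ^ k * ((3 : ℕ) : ℤ))) 1) (s : ℤ_[3]),
          resSubgroup (W.torsionGaloisModule (((3 : ℕ) : ℤ) ^ k * ((3 : ℕ) : ℤ))).toTopRep (cycSubgroup 3 0 r) 1 κ₀ =
              Ψ y →
          galoisCohomology.localization (W.torsionGaloisModule (((3 : ℕ) : ℤ) ^ k * ((3 : ℕ) : ℤ))) (Sum.inr v₃) 1 κ₀ ∈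
              propagatedSelmerStructure W 3 k (Sum.inr v₃) →
          (∃ l ∈ cycIntLattice 3 (cycLevel 3 0 r),
              ((3 : ℕ) : ℤ_[3]) • Λ 0 r y -
                  (((s * (((3 : ℕ) : ℤ_[3]) - (ap : ℤ_[3]) + 1) : ℤ_[3]) : ℚ_[3]) ⊗ₜ[ℚ]
                    (1 : CyclotomicField (cycLevel 3 0 r) ℚ)) =
                ((3 : ℤ_[3]) ^ (k + 1)) • ∑ g : (ZMod (cycLevel 3 0 r))ˣ,
                  ((((((3 : ℕ) : MonoidAlgebra ℤ_[3] (ZMod (cycLevel 3 0 r))ˣ)) -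
                      MonoidAlgebra.single w (ap : ℤ_[3]) +
                      MonoidAlgebra.single (w ^ 2) (1 : ℤ_[3])).coeff g : ℤ_[3]) : ℚ_[3]) •
                    Algebra.TensorProduct.map (AlgHom.id ℚ ℚ_[3])
                      (sigma (cycLevel 3 0 r) g : CyclotomicField (cycLevel 3 0 r) ℚ →ₐ[ℚ]
                        CyclotomicField (cycLevel 3 0 r) ℚ) l) →
          Λk (galoisCohomology.localization (W.torsionGaloisModule (((3 : ℕ) : ℤ) ^ k * ((3 : ℕ) : ℤ)))
              (Sum.inr v₃) 1 κ₀) = PadicInt.toZModPow (k + 1) s)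
    -- the ANOMALOUS rider's scalar clause (ii_τ): the premise is stated on the TWISTED lattice `(1 ⊗ P_w)·L_int`,
    -- `P_w = p − a_pδ_w + δ_{w²}`, `w·[p] = 1`, with the scalar `s·(p − a_p + 1) = s·#Ẽ(𝔽_p)`
    (hfinτm : ∀ (r : Finset (HeightOneSpectrum (𝓞 ℚ))) (w : (ZMod (cycLevel 3 0 r))ˣ),
      (w : ZMod (cycLevel 3 0 r)) * ((3 : ℕ) : ZMod (cycLevel 3 0 r)) = 1 →
      ∀ (Ψ : H1 (tateRep W 3) (cycSubgroup 3 0 r) →+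
          continuousCohomology 1
            (subgroupRep (W.torsionGaloisModule (((3 : ℕ) : ℤ) ^ m * ((3 : ℕ) : ℤ))).toTopRep (cycSubgroup 3 0 r))),
        (∀ (φ : contOneCocycles (subgroupRep (tateRep W 3).toTopRep (cycSubgroup 3 0 r)))
            (ψ : contOneCocycles
              (subgroupRep (W.torsionGaloisModule (((3 : ℕ) : ℤ) ^ m * ((3 : ℕ) : ℤ))).toTopRep (cycSubgroup 3 0 r))),
            (∀ g, ((ψ.1 g : geomTorsion W (((3 : ℕ) : ℤ) ^ m * ((3 : ℕ) : ℤ))) : geomPoints W) =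
              TateModule.proj 3 (m + 1) (φ.1 g)) →
            Ψ (oneCocycleClass _ φ) = oneCocycleClass _ ψ) →
        ∀ (y : H1 (tateRep W 3) (cycSubgroup 3 0 r))
          (κ₀ : galoisCohomology (W.torsionGaloisModule (((3 : ℕ) : ℤ) ^ m * ((3 : ℕ) : ℤ))) 1) (s : ℤ_[3]),
          resSubgroup (W.torsionGaloisModule (((3 : ℕ) : ℤ) ^ m * ((3 : ℕ) : ℤ))).toTopRep (cycSubgroup 3 0 r) 1 κ₀ =
              Ψ y →
          galoisCohomology.localization (W.torsionGaloisModule (((3 : ℕ) : ℤ) ^ m * ((3 : ℕ) : ℤ))) (Sum.inr v₃) 1 κ₀ ∈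
              propagatedSelmerStructure W 3 m (Sum.inr v₃) →
          (∃ l ∈ cycIntLattice 3 (cycLevel 3 0 r),
              ((3 : ℕ) : ℤ_[3]) • Λ 0 r y -
                  (((s * (((3 : ℕ) : ℤ_[3]) - (ap : ℤ_[3]) + 1) : ℤ_[3]) : ℚ_[3]) ⊗ₜ[ℚ]
                    (1 : CyclotomicField (cycLevel 3 0 r) ℚ)) =
                ((3 : ℤ_[3]) ^ (m + 1)) • ∑ g : (ZMod (cycLevel 3 0 r))ˣ,
                  ((((((3 : ℕ) : MonoidAlgebra ℤ_[3] (ZMod (cycLevel 3 0 r))ˣ)) -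
                      MonoidAlgebra.single w (ap : ℤ_[3]) +
                      MonoidAlgebra.single (w ^ 2) (1 : ℤ_[3])).coeff g : ℤ_[3]) : ℚ_[3]) •
                    Algebra.TensorProduct.map (AlgHom.id ℚ ℚ_[3])
                      (sigma (cycLevel 3 0 r) g : CyclotomicField (cycLevel 3 0 r) ℚ →ₐ[ℚ]
                        CyclotomicField (cycLevel 3 0 r) ℚ) l) →
          Λm (galoisCohomology.localization (W.torsionGaloisModule (((3 : ℕ) : ℤ) ^ m * ((3 : ℕ) : ℤ)))
              (Sum.inr v₃) 1 κ₀) = PadicInt.toZModPow (m + 1) s)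
    -- the two data, canonical for the SAME `η`, with usable Kolyvagin primes
    (D : KolyvaginDatum (W.torsionGaloisModule (((3 : ℕ) : ℤ) ^ k * ((3 : ℕ) : ℤ))))
    (hT : D.transverse = cyclotomicTransverse (W.torsionGaloisModule (((3 : ℕ) : ℤ) ^ k * ((3 : ℕ) : ℤ))))
    (D'' : KolyvaginDatum (W.torsionGaloisModule (((3 : ℕ) : ℤ) ^ m * ((3 : ℕ) : ℤ))))
    (hT'' : D''.transverse =
      cyclotomicTransverse (W.torsionGaloisModule (((3 : ℕ) : ℤ) ^ m * ((3 : ℕ) : ℤ))))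
    {η : (q : HeightOneSpectrum (𝓞 ℚ)) → (ZMod (Ideal.absNorm q.asIdeal))ˣ}
    (hD : D.HasCanonicalComparison (3 ^ (k + 1)) η) (hD'' : D''.HasCanonicalComparison (3 ^ (m + 1)) η)
    (hPr : D.primes ⊆ (cyclotomicLevelsRat 3 (badPlaces c d A N)).primes)
    (hPr'' : D''.primes ⊆ (cyclotomicLevelsRat 3 (badPlaces c d A N)).primes)
    (hKol : ∀ q ∈ D.primes, Kato.IsKolyvaginPrime W 3 (k + 1) ((primesEquiv q : Nat.Primes) : ℕ))
    (hKol'' : ∀ q ∈ D''.primes, Kato.IsKolyvaginPrime W 3 (m + 1) ((primesEquiv q : Nat.Primes) : ℕ))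
    -- THEOREM D's row binders at the place `3` only (NO `hbad`: anomalous bad places allowed)
    (htopk : ∀ w : HeightOneSpectrum (𝓞 ℚ), ((primesEquiv w : Nat.Primes) : ℕ) = 3 →
      propagatedSelmerStructure W 3 k (Sum.inr w) = ⊤)
    (htopm : ∀ w : HeightOneSpectrum (𝓞 ℚ), ((primesEquiv w : Nat.Primes) : ℕ) = 3 →
      propagatedSelmerStructure W 3 m (Sum.inr w) = ⊤)
    -- the VALUE ROWS at depth `k` and at depth `m` (T-PK6-VAL's OUT, displayed)
    (hvalk : ∀ σ : HeightOneSpectrum (𝓞 ℚ) → absoluteGaloisGroup ℚ,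
      (∀ q, σ q ∈ (adicCompletionPrime ℚ q).inertia (absoluteGaloisGroup ℚ)) →
      (∀ q, modNCyclotomicCharacter ℚ (Ideal.absNorm q.asIdeal) (σ q) = η q) →
      ∀ (r : Finset (HeightOneSpectrum (𝓞 ℚ))) (hr : (↑r : Set _) ⊆ D.primes),
        ∃ (w : (ZMod (cycLevel 3 0 r))ˣ), (w : ZMod (cycLevel 3 0 r)) * ((3 : ℕ) : ZMod (cycLevel 3 0 r)) = 1 ∧
        ∃ (s : ℤ_[3]) (u : (ZMod (3 ^ (k + 1)))ˣ)
          (ψ : (ℓ : ℕ) → (ZMod ℓ)ˣ →* Multiplicative (ZMod (3 ^ (k + 1)))),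
          (∀ q ∈ r, Function.Surjective (ψ (Ideal.absNorm q.asIdeal))) ∧
          (∃ l ∈ cycIntLattice 3 (cycLevel 3 0 r),
            ((3 : ℕ) : ℤ_[3]) • ((1 : ℚ_[3]) ⊗ₜ[ℚ]
              ((r.noncommProd 𝐃F⟦r, σ⟧ (ZetaValue.pairwise_commute_fieldDeriv (cycLevel 3 0 r)
                  (fun ℓ => modNCyclotomicCharacter ℚ (cycLevel 3 0 r) (σ ℓ))
                  (fun ℓ => ((primesEquiv ℓ : Nat.Primes) : ℕ) - 1) r))
                (x 0 ⟨r, fun _ hq => hPr (hr (Finset.mem_coe.2 hq))⟩ +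
                  sigma (cycLevel 3 0 r) (-1) (x 0 ⟨r, fun _ hq => hPr (hr (Finset.mem_coe.2 hq))⟩)))) -
              (((s * (((3 : ℕ) : ℤ_[3]) - (ap : ℤ_[3]) + 1) : ℤ_[3]) : ℚ_[3]) ⊗ₜ[ℚ]
                (1 : CyclotomicField (cycLevel 3 0 r) ℚ)) =
            (((3 : ℕ) : ℤ_[3]) ^ (k + 1)) • ∑ g : (ZMod (cycLevel 3 0 r))ˣ,
              ((((((3 : ℕ) : MonoidAlgebra ℤ_[3] (ZMod (cycLevel 3 0 r))ˣ)) -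
                  MonoidAlgebra.single w (ap : ℤ_[3]) +
                  MonoidAlgebra.single (w ^ 2) (1 : ℤ_[3])).coeff g : ℤ_[3]) : ℚ_[3]) •
                Algebra.TensorProduct.map (AlgHom.id ℚ ℚ_[3])
                  (sigma (cycLevel 3 0 r) g : CyclotomicField (cycLevel 3 0 r) ℚ →ₐ[ℚ]
                    CyclotomicField (cycLevel 3 0 r) ℚ) l) ∧
          haveI : NeZero (∏ q ∈ r, Ideal.absNorm q.asIdeal) :=
            ⟨Finset.prod_ne_zero_iff.2 fun q _ h => q.ne_bot (Ideal.absNorm_eq_zero_iff.1 h)⟩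
          PadicInt.toZModPow (k + 1) s = (u : ZMod (3 ^ (k + 1))) *
            ((3 : ℕ) : ZMod (3 ^ (k + 1))) ^ (0 : ℕ) *
              kuriharaNumber P.f (3 ^ (k + 1)) (∏ q ∈ r, Ideal.absNorm q.asIdeal) ψ)
    (hvalm : ∀ σ : HeightOneSpectrum (𝓞 ℚ) → absoluteGaloisGroup ℚ,
      (∀ q, σ q ∈ (adicCompletionPrime ℚ q).inertia (absoluteGaloisGroup ℚ)) →
      (∀ q, modNCyclotomicCharacter ℚ (Ideal.absNorm q.asIdeal) (σ q) = η q) →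
      ∀ (r : Finset (HeightOneSpectrum (𝓞 ℚ))) (hr : (↑r : Set _) ⊆ D''.primes),
        ∃ (w : (ZMod (cycLevel 3 0 r))ˣ), (w : ZMod (cycLevel 3 0 r)) * ((3 : ℕ) : ZMod (cycLevel 3 0 r)) = 1 ∧
        ∃ (s : ℤ_[3]) (u : (ZMod (3 ^ (m + 1)))ˣ)
          (ψ : (ℓ : ℕ) → (ZMod ℓ)ˣ →* Multiplicative (ZMod (3 ^ (m + 1)))),
          (∀ q ∈ r, Function.Surjective (ψ (Ideal.absNorm q.asIdeal))) ∧
          (∃ l ∈ cycIntLattice 3 (cycLevel 3 0 r),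
            ((3 : ℕ) : ℤ_[3]) • ((1 : ℚ_[3]) ⊗ₜ[ℚ]
              ((r.noncommProd 𝐃F⟦r, σ⟧ (ZetaValue.pairwise_commute_fieldDeriv (cycLevel 3 0 r)
                  (fun ℓ => modNCyclotomicCharacter ℚ (cycLevel 3 0 r) (σ ℓ))
                  (fun ℓ => ((primesEquiv ℓ : Nat.Primes) : ℕ) - 1) r))
                (x 0 ⟨r, fun _ hq => hPr'' (hr (Finset.mem_coe.2 hq))⟩ +
                  sigma (cycLevel 3 0 r) (-1) (x 0 ⟨r, fun _ hq => hPr'' (hr (Finset.mem_coe.2 hq))⟩)))) -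
              (((s * (((3 : ℕ) : ℤ_[3]) - (ap : ℤ_[3]) + 1) : ℤ_[3]) : ℚ_[3]) ⊗ₜ[ℚ]
                (1 : CyclotomicField (cycLevel 3 0 r) ℚ)) =
            (((3 : ℕ) : ℤ_[3]) ^ (m + 1)) • ∑ g : (ZMod (cycLevel 3 0 r))ˣ,
              ((((((3 : ℕ) : MonoidAlgebra ℤ_[3] (ZMod (cycLevel 3 0 r))ˣ)) -
                  MonoidAlgebra.single w (ap : ℤ_[3]) +
                  MonoidAlgebra.single (w ^ 2) (1 : ℤ_[3])).coeff g : ℤ_[3]) : ℚ_[3]) •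
                Algebra.TensorProduct.map (AlgHom.id ℚ ℚ_[3])
                  (sigma (cycLevel 3 0 r) g : CyclotomicField (cycLevel 3 0 r) ℚ →ₐ[ℚ]
                    CyclotomicField (cycLevel 3 0 r) ℚ) l) ∧
          haveI : NeZero (∏ q ∈ r, Ideal.absNorm q.asIdeal) :=
            ⟨Finset.prod_ne_zero_iff.2 fun q _ h => q.ne_bot (Ideal.absNorm_eq_zero_iff.1 h)⟩
          PadicInt.toZModPow (m + 1) s = (u : ZMod (3 ^ (m + 1))) *
            ((3 : ℕ) : ZMod (3 ^ (m + 1))) ^ (0 : ℕ) *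
              kuriharaNumber P.f (3 ^ (m + 1)) (∏ q ∈ r, Ideal.absNorm q.asIdeal) ψ) :
    ∃ (κf : Finset (HeightOneSpectrum (𝓞 ℚ)) →
          galoisCohomology (W.torsionGaloisModule (((3 : ℕ) : ℤ) ^ k * ((3 : ℕ) : ℤ))) 1)
      (κu : Finset (HeightOneSpectrum (𝓞 ℚ)) →
          galoisCohomology (W.torsionGaloisModule (((3 : ℕ) : ℤ) ^ m * ((3 : ℕ) : ℤ))) 1),
      KatoKuriharaWitnessAt W k 0 D v₃ P κf Λk κf ∧
      KatoKuriharaWitnessAt W m 0 D'' v₃ P κu Λm κu ∧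
      ∀ e, D''.IsLevel e → D.IsLevel e → galoisCohomology.map π 1 (κu e) = κf e := by
  letI := TorsionCoeff.torsionBy.padicIntModule 3 (k + 1) (WeierstrassCurve.geomPoints W)
  letI := TorsionCoeff.torsionBy.padicIntModule 3 (m + 1) (WeierstrassCurve.geomPoints W)
  have hv₃p : ((primesEquiv v₃ : Nat.Primes) : ℕ) = 3 := primesEquiv_eq_of_natCast_mem Nat.prime_three hv₃
  -- the two coefficient systems `E[3^{j+1}]_{ℤ₃}` (GZ-2), reductions onto, pins `rfl`
  have hredk : Function.Surjective
      (tateModuleRed W 3 (W.continuous_galoisRepTate_holds 3) (k + 1)).hom := by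
    intro y
    obtain ⟨b, hb⟩ := W.proj_surjective_of_isAlgClosed_holds 3 (k + 1) y.2
    exact ⟨b, Subtype.ext hb⟩
  have hredm : Function.Surjective
      (tateModuleRed W 3 (W.continuous_galoisRepTate_holds 3) (m + 1)).hom := by
    intro y
    obtain ⟨b, hb⟩ := W.proj_surjective_of_isAlgClosed_holds 3 (m + 1) y.2
    exact ⟨b, Subtype.ext hb⟩
  -- THEOREM D-u at the two depths for Kato's system `z` (no `hbad`): ONE `σ`, (COMP); the
  -- anomalous bad places are served by (C2) = `hbody.2.1`
  obtain ⟨σ, Φ, comm, κf, Φ'', comm'', κu, hσI, hσχ, hΦ, hΦ'', hKS, hKS'', -, -, hres, hres'', hcomp⟩ :=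
    KimAtThreeDeepUpperKolyvaginPair.exists_isKolyvaginSystem_pair_propagatedSelmerStructure_of_unramified
      W (badPlaces c d A N) hkm hbody.1
      (tateModuleRed W 3 (W.continuous_galoisRepTate_holds 3) (k + 1)) hredk
      (fun y => pow_smul_eq_zero 3 (k + 1) _ y)
      (AddSubgroup.inclusion (geomTorsion_pow_succ_eq W 3 k).le : _ →+ _) continuous_of_discreteTopology
      (fun _ _ => rfl)
      (AddSubgroup.inclusion (geomTorsion_pow_succ_eq W 3 k).ge : _ →+ _) continuous_of_discreteTopology
      (fun y => Subtype.ext rfl) (fun y => Subtype.ext rfl) (fun _ => rfl)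
      (tateModuleRed W 3 (W.continuous_galoisRepTate_holds 3) (m + 1)) hredm
      (fun y => pow_smul_eq_zero 3 (m + 1) _ y)
      (AddSubgroup.inclusion (geomTorsion_pow_succ_eq W 3 m).le : _ →+ _) continuous_of_discreteTopology
      (fun _ _ => rfl)
      (AddSubgroup.inclusion (geomTorsion_pow_succ_eq W 3 m).ge : _ →+ _) continuous_of_discreteTopology
      (fun y => Subtype.ext rfl) (fun y => Subtype.ext rfl) (fun _ => rfl)
      π hπ hirr D hT D'' hT'' hD hD'' hPr hPr'' hKol hKol'' hbody.2.1 htopk htopm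
  refine ⟨κf, κu, ?_, ?_, fun e he'' he => hcomp e he he''⟩
  · -- depth `k`: (0), (I4) with `κ′ = κ`, (Λ) from the rider, (DICT3) per level from T-PK6-GEN
    refine ⟨fun e he => hKS.mem_selmerGroup e he,
      ⟨hKS, fun e _ => by rw [sub_self]; exact zero_mem _⟩, hΛk.1, hΛk.2, fun r hr => ?_⟩
    obtain ⟨w, hw₁, s, u, ψ, hψ, hval, hw⟩ := hvalk σ hσI hσχ r hr
    obtain ⟨u', hu'⟩ :=
      KimAtThreeShallowEqDeepAnomalousRiderGeneralLevel.exists_unit_apply_localization_eq_of_derivativeFamily_twist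
      W 3 P.f ι κK Λ c d a A z x (by decide) hbody ap hfinτk
      (tateModuleRed W 3 (W.continuous_galoisRepTate_holds 3) (k + 1))
      (AddSubgroup.inclusion (geomTorsion_pow_succ_eq W 3 k).le : _ →+ _) continuous_of_discreteTopology
      (fun _ _ => rfl) (fun _ => rfl) D hPr σ Φ comm κf hΦ hKS hres hv₃p r hr w hw₁ s hval u hw
    exact ⟨u', ψ, hψ, hu'⟩
  · -- depth `m`: the same
    refine ⟨fun e he => hKS''.mem_selmerGroup e he,
      ⟨hKS'', fun e _ => by rw [sub_self]; exact zero_mem _⟩, hΛm.1, hΛm.2, fun r hr => ?_⟩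
    obtain ⟨w, hw₁, s, u, ψ, hψ, hval, hw⟩ := hvalm σ hσI hσχ r hr
    obtain ⟨u', hu'⟩ :=
      KimAtThreeShallowEqDeepAnomalousRiderGeneralLevel.exists_unit_apply_localization_eq_of_derivativeFamily_twist
      W 3 P.f ι κK Λ c d a A z x (by decide) hbody ap hfinτm
      (tateModuleRed W 3 (W.continuous_galoisRepTate_holds 3) (m + 1))
      (AddSubgroup.inclusion (geomTorsion_pow_succ_eq W 3 m).le : _ →+ _) continuous_of_discreteTopology
      (fun _ _ => rfl) (fun _ => rfl) D'' hPr'' σ Φ'' comm'' κu hΦ'' hKS'' hres'' hv₃p r hr w hw₁ s hval u hw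
    exact ⟨u', ψ, hψ, hu'⟩


end Summit.BirchSwinnertonDyer.BirchSwinnertonDyer.Theorems.KimAtThreeShallowEqDeepAnomalousWitnessPairUnramified

end
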